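import Summits.FinalStateConjecture.FinalStateConjecture.Theses.StarvedNecks

/-!
# Route StarvedNecks · item `Assembly` (stmt-FinalStateConjecture-13554)

Pure logic. The route decl
`Summit.FinalStateConjecture.FinalStateConjecture.Theses.StarvedNecks.Assembly` reads
`HonestFixedRadiusSettling → NecksCertify → SeamedChartsExhaust → FinalStateConjecture`,
which is verbatim the type of the route's (sorry-free) deciding theorem
`Theses.StarvedNecks.closes`: Christodoulou genericity `IsChristodoulouGeneric 𝓓 P 1` is antitone
in the exceptional set, so the pointwise implication on admissible data — `NecksCertify` re-seams
the honest fixed-radius C⁴ decomposition of `HonestFixedRadiusSettling` into a C² `SEAMED` one of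
the same self-determined exterior, `SeamedChartsExhaust` turns that into `HasExhaustiveCharts`,
and sub-extremality of the holes is the first conjunct of `HonestCore` — transfers genericity from
the hypothesis property to the Statement's property. No hypothesis beyond the three displayed ones
enters; the proof is `closes` itself.
-/

-- `Summit.FinalStateConjecture.FinalStateConjecture.…` is the tree's mandated namespace (summit = sub-problem).
set_option linter.dupNamespace false

namespace Summit.FinalStateConjecture.FinalStateConjecture.Theorems

/-- **Item `Assembly` (stmt-FinalStateConjecture-13554), route StarvedNecks.**
`HonestFixedRadiusSettling → NecksCertify → SeamedChartsExhaust → FinalStateConjecture`: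
after unfolding, this is exactly the route's deciding theorem
`Theses.StarvedNecks.closes` (antitone-genericity transfer of the pointwise implication
G-property ⇒ Statement-property on admissible data). Pure logic; closes the assembly item. -/
theorem StarvedNecks.assembly_proof :
    Summit.FinalStateConjecture.FinalStateConjecture.Theses.StarvedNecks.Assembly := by
  unfold Summit.FinalStateConjecture.FinalStateConjecture.Theses.StarvedNecks.Assembly
  exact Summit.FinalStateConjecture.FinalStateConjecture.Theses.StarvedNecks.closes

end Summit.FinalStateConjecture.FinalStateConjecture.Theorems
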